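import Mathlib
import HarnessLib
import Literature.Analysis.FluidPDE.ClassicalSolutionRegion
import Literature.Analysis.FluidPDE.AxisymHouLiVariables
import Summits.NavierStokesRegularity.NavierStokesRegularity.Theorems.PoloidalWindowDoorPoloidalWindowRigidityLocalFrozenLaw

/-!
# Crux `PoloidalWindowRigidity` (K2, stmt-…-19708), line `local_rigidity`, stub S2 `stub_localThickTH` — REDUCTION of S2 to ONE
# velocity-only local emptiness statement `hempty_thick` (the THICK twin of K2-p3's `hempty`)

Cell ns-regularity-ideate, pool seat ns-poloidal-K2-p5 (`--supports stmt-NavierStokesRegularity-19708`).  `hempty_thick` := no real-analytic `u` on an open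
`U ∋ p₀` satisfies on `U` (i) `div u = 0`, (ii) `∂₀u₁ = ∂₁u₀`, (iii) the frozen law `∂₂u₀∂₁u₂ = ∂₂u₁∂₀u₂`, (iv) the vorticity equation in primitive form
`∂_j(𝓛u_k) = ∂_k(𝓛u_j)`, `𝓛u_k = ∂ₜu_k + u·∇u_k − Δu_k` (nsreg-p7 shapes), and AT `p₀`: twist ≠ 0, `∇ₕu₂ ≠ 0`, `∂₂u_h ≠ 0`, `curl u ≠ 0`, THICKNESS
`∇ₕΛ(p₀) ≠ 0` for the slope `Λ = ⟨∂₂u_h, ∇ₕu₂⟩/|∇ₕu₂|²`.  Contents: `curl_momentum_eq_zero` / `vorticity_law` (REGION solutions: the slice field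
`∂ₜu + (u·∇)u − νΔu` is `−∇q` near each point, so its curl vanishes; primitive coordinates by localisation, `…LocalFrozenLaw`);
`differentiableAt_fderiv_slice_apply`, `differentiableAt_slope`; `eq_vertical_of_horizFDeriv_eq_zero` (horizontal mean value in a ball);
`stub_localThickTH_of_localEmptyThick : hempty_thick → <stub_localThickTH verbatim>` (dichotomy: a thick point ⇒ `hempty_thick` bites, laws (i)–(iv) from
`divFree`, the hypothesis, `vertShear_wedge_horizGrad_eq_zero`, `vorticity_law`; else `∂₀Λ = ∂₁Λ = 0` on `U` and on a ball the slope is `Λ(t, c + (y₂−c₂)e₃)`).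
No class input; analyticity is only passed through.  WHAT THIS IS NOT: not a proof of S2 or of anything about Navier–Stokes regularity — kernel plumbing
that makes the THICK column's local statement a pure differential-algebra target.
-/

noncomputable section

-- the summit and its single sub-problem share the name (CONVENTIONS §1), as in every Theorems file
set_option linter.dupNamespace false

namespace Summit.NavierStokesRegularity.NavierStokesRegularity.Theorems.PoloidalWindowDoorPoloidalWindowRigidityLocalThickOfLocalEmpty

open Set Function Filter Topology Metric
open scoped RealInnerProductSpace InnerProductSpace Laplacian ContDiff
open Literature.Analysis Literature.Analysis.FluidPDE
open Summit.NavierStokesRegularity.NavierStokesRegularity.Theorems.PoloidalWindowDoorPoloidalWindowRigidityLocalFrozenLaw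

variable {U : Set (ℝ × EuclideanSpace ℝ (Fin 3))} {ν : ℝ} {u : ℝ → EuclideanSpace ℝ (Fin 3) → EuclideanSpace ℝ (Fin 3)}
  {q : ℝ → EuclideanSpace ℝ (Fin 3) → ℝ}

/-- A real functional on `ℝ³` in coordinates: `ℓ v = Σᵢ vᵢ ℓ(eᵢ)`. -/
theorem clm_real_apply_coord (ℓ : EuclideanSpace ℝ (Fin 3) →L[ℝ] ℝ) (v : EuclideanSpace ℝ (Fin 3)) :
    ℓ v = ∑ i, v i * ℓ (EuclideanSpace.single i 1) := by
  have hv : v = ∑ i, v i • (EuclideanSpace.single i (1 : ℝ) : EuclideanSpace ℝ (Fin 3)) := by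
    simpa using ((EuclideanSpace.basisFun (Fin 3) ℝ).sum_repr v).symm
  conv_lhs => rw [hv]
  simp [map_sum, map_smul]

/-- **`curl (∂ₜu + (u·∇)u − νΔu) = 0` on an open region.**  For a classical Navier–Stokes pair on an open region `U` (no force), the slice
field `y ↦ ∂ₜu(t,y) + (u·∇)u(t,y) − νΔu(t,y)` coincides near every point of the space section with `−∇q(t,·)`, whose curl vanishes. -/
theorem curl_momentum_eq_zero (hU : IsOpen U) (h : IsClassicalNSSolutionOnRegion U ν 0 u q)
    {p : ℝ × EuclideanSpace ℝ (Fin 3)} (hp : p ∈ U) :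
    curl (fun y => deriv (fun s => u s y) p.1 + convect (u p.1) (u p.1) y - ν • (Δ (u p.1)) y) p.2 = 0 := by
  obtain ⟨v, r, V, -, hr, hV, hpV, hVU, -, hrq⟩ := exists_contDiff_localisation hU h hp
  have hrs : IsSmoothSpaceTimeOn univ r := by rw [IsSmoothSpaceTimeOn, univ_prod_univ]; exact hr.contDiffOn
  have hr2 : ContDiff ℝ 2 (r p.1) := (hrs.contDiff_slice (mem_univ p.1)).of_le (by norm_cast)
  have hVt : {y : EuclideanSpace ℝ (Fin 3) | (p.1, y) ∈ V} ∈ 𝓝 p.2 :=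
    (hV.preimage (Continuous.prodMk_right p.1)).mem_nhds hpV
  have hgerm : ∀ z ∈ V, uncurry r =ᶠ[𝓝 z] uncurry q := fun z hz => by
    filter_upwards [hV.mem_nhds hz] with w hw using hrq w hw
  have hF : (fun y => deriv (fun s => u s y) p.1 + convect (u p.1) (u p.1) y - ν • (Δ (u p.1)) y) =ᶠ[𝓝 p.2]
      fun y => -gradient (r p.1) y := by
    filter_upwards [hVt] with y hy
    have e := h.momentum_deriv hU (hVU hy)
    have h5 : gradient (r p.1) y = gradient (q p.1) y := by
      unfold gradient; rw [fderiv_slice_congr_of_eventuallyEq (hgerm (p.1, y) hy)]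
    simp only [Pi.zero_apply, add_zero] at e
    rw [h5, e]; abel
  rw [curl_congr_of_eventuallyEq hF, curl_neg, curl_gradient_eq_zero_holds _ hr2, neg_zero]

/-- Time-line / slice / Laplacian coordinates for a GLOBALLY smooth space–time field: the `k`-th component of
`∂ₜv + (v·∇)v − νΔv` at `(t,y)` is `∂ₜv_k + Dv_k[v] − νΔv_k`. -/
theorem momentum_apply_coord {v : ℝ → EuclideanSpace ℝ (Fin 3) → EuclideanSpace ℝ (Fin 3)} (hv : ContDiff ℝ ∞ (uncurry v))
    (t : ℝ) (y : EuclideanSpace ℝ (Fin 3)) (k : Fin 3) :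
    (deriv (fun s => v s y) t + convect (v t) (v t) y - ν • (Δ (v t)) y) k =
      deriv (fun s => v s y k) t + fderiv ℝ (fun y' => v t y' k) y (v t y) - ν * (Δ (fun y' => v t y' k)) y := by
  have hvs : IsSmoothSpaceTimeOn univ v := by rw [IsSmoothSpaceTimeOn, univ_prod_univ]; exact hv.contDiffOn
  have hvt : ContDiff ℝ ∞ (v t) := hvs.contDiff_slice (mem_univ t)
  have hd : DifferentiableAt ℝ (v t) y := (hvt.differentiable (by simp)) y
  -- time line
  have hline : HasDerivAt (fun s => v s y) (deriv (fun s => v s y) t) t :=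
    (hvs.differentiableWithinAt_time (mem_univ t) y).differentiableAt (univ_mem) |>.hasDerivAt
  have h1 : deriv (fun s => v s y k) t = deriv (fun s => v s y) t k := by
    have := ((EuclideanSpace.proj k : EuclideanSpace ℝ (Fin 3) →L[ℝ] ℝ).hasFDerivAt.comp_hasDerivAt t hline).deriv
    exact this
  have h2 : fderiv ℝ (fun y' => v t y' k) y (v t y) = fderiv ℝ (v t) y (v t y) k := fderiv_apply_coord hd (v t y) k
  have h3 : (Δ (fun y' => v t y' k)) y = (Δ (v t)) y k := (laplacian_apply_coord (hvt.contDiffAt.of_le (by norm_cast)) k).symm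
  rw [h1, h2, h3]
  rfl

/-- **The vorticity equation in primitive coordinates, for a REGION solution**: at every point of the open region,
`∂_j(∂ₜu_k + u·∇u_k − νΔu_k) = ∂_k(∂ₜu_j + u·∇u_j − νΔu_j)` for all `j, k` (the curl of the momentum equation vanishes; the pressure is gone). -/
theorem vorticity_law (hU : IsOpen U) (h : IsClassicalNSSolutionOnRegion U ν 0 u q)
    {p : ℝ × EuclideanSpace ℝ (Fin 3)} (hp : p ∈ U) (j k : Fin 3) :
    fderiv ℝ (fun y => deriv (fun s => u s y k) p.1 + fderiv ℝ (fun y' => u p.1 y' k) y (u p.1 y) - ν * (Δ (fun y' => u p.1 y' k)) y) p.2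
        (EuclideanSpace.single j 1) =
      fderiv ℝ (fun y => deriv (fun s => u s y j) p.1 + fderiv ℝ (fun y' => u p.1 y' j) y (u p.1 y) - ν * (Δ (fun y' => u p.1 y' j)) y) p.2
        (EuclideanSpace.single k 1) := by
  obtain ⟨v, r, V, hv, -, hV, hpV, hVU, hvu, -⟩ := exists_contDiff_localisation hU h hp
  have hvs : IsSmoothSpaceTimeOn univ v := by rw [IsSmoothSpaceTimeOn, univ_prod_univ]; exact hv.contDiffOn
  have hgerm : ∀ z ∈ V, uncurry v =ᶠ[𝓝 z] uncurry u := fun z hz => by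
    filter_upwards [hV.mem_nhds hz] with w hw using hvu w hw
  have hVt : {y : EuclideanSpace ℝ (Fin 3) | (p.1, y) ∈ V} ∈ 𝓝 p.2 :=
    (hV.preimage (Continuous.prodMk_right p.1)).mem_nhds hpV
  -- the momentum slice field of `u` and of `v` agree near `p.2`, componentwise in primitive coordinates
  set G : EuclideanSpace ℝ (Fin 3) → EuclideanSpace ℝ (Fin 3) :=
    fun y => deriv (fun s => v s y) p.1 + convect (v p.1) (v p.1) y - ν • (Δ (v p.1)) y with hG
  have hGu : G =ᶠ[𝓝 p.2] fun y => deriv (fun s => u s y) p.1 + convect (u p.1) (u p.1) y - ν • (Δ (u p.1)) y := by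
    filter_upwards [hVt] with y hy
    have hg := hgerm (p.1, y) hy
    rw [hG]
    show deriv (fun s => v s y) p.1 + convect (v p.1) (v p.1) y - ν • (Δ (v p.1)) y =
      deriv (fun s => u s y) p.1 + convect (u p.1) (u p.1) y - ν • (Δ (u p.1)) y
    rw [convect_apply, convect_apply, (eventuallyEq_timeLine_of_eventuallyEq_uncurry hg).deriv_eq,
      fderiv_slice_congr_of_eventuallyEq hg, hvu (p.1, y) hy,
      (InnerProductSpace.laplacian_congr_nhds (eventuallyEq_slice_of_eventuallyEq_uncurry hg)).self_of_nhds]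
  have hcoord : ∀ i : Fin 3, (fun y => G y i) =ᶠ[𝓝 p.2]
      fun y => deriv (fun s => u s y i) p.1 + fderiv ℝ (fun y' => u p.1 y' i) y (u p.1 y) - ν * (Δ (fun y' => u p.1 y' i)) y := by
    intro i
    filter_upwards [hVt] with y hy
    have hg := hgerm (p.1, y) hy
    rw [hG]
    show (deriv (fun s => v s y) p.1 + convect (v p.1) (v p.1) y - ν • (Δ (v p.1)) y) i = _
    rw [momentum_apply_coord hv p.1 y i]
    -- transfer each primitive term from `v` to `u`
    have e1 : deriv (fun s => v s y i) p.1 = deriv (fun s => u s y i) p.1 := by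
      refine Filter.EventuallyEq.deriv_eq ?_
      filter_upwards [eventuallyEq_timeLine_of_eventuallyEq_uncurry hg] with s hs
      exact congrFun (congrArg _ hs) i |>.trans rfl
    have e2 : fderiv ℝ (fun y' => v p.1 y' i) y = fderiv ℝ (fun y' => u p.1 y' i) y := by
      refine Filter.EventuallyEq.fderiv_eq ?_
      filter_upwards [eventuallyEq_slice_of_eventuallyEq_uncurry hg] with y' hy'
      exact congrFun (congrArg _ hy') i |>.trans rfl
    have e3 : (Δ (fun y' => v p.1 y' i)) y = (Δ (fun y' => u p.1 y' i)) y := by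
      refine (InnerProductSpace.laplacian_congr_nhds ?_).self_of_nhds
      filter_upwards [eventuallyEq_slice_of_eventuallyEq_uncurry hg] with y' hy'
      exact congrFun (congrArg _ hy') i |>.trans rfl
    rw [e1, e2, e3, hvu (p.1, y) hy]
  -- `curl G = 0` at `p.2` (region solution ⇒ for `u`; transfer to `v` by the germ)
  have hcurl : curl G p.2 = 0 := by
    rw [curl_congr_of_eventuallyEq hGu]; exact curl_momentum_eq_zero hU h hp
  -- differentiability of `G` at `p.2`
  have hT : ContDiff ℝ ∞ fun y => deriv (fun s => v s y) p.1 := by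
    have h1 := (hvs.timeDerivWithin uniqueDiffOn_univ).contDiff_slice (mem_univ p.1)
    have e : (fun y => deriv (fun s => v s y) p.1) = timeDerivWithin univ v p.1 := by
      funext y; simp [timeDerivWithin_apply, derivWithin_univ]
    rw [e]; exact h1
  have hC : ContDiff ℝ ∞ fun y => convect (v p.1) (v p.1) y := (hvs.convect hvs uniqueDiffOn_univ).contDiff_slice (mem_univ p.1)
  have hΔ : ContDiff ℝ ∞ fun y => (Δ (v p.1)) y := (hvs.laplacian uniqueDiffOn_univ).contDiff_slice (mem_univ p.1)
  have hGd : DifferentiableAt ℝ G p.2 := by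
    rw [hG]
    exact (((hT.differentiable (by simp)) p.2).add ((hC.differentiable (by simp)) p.2)).sub
      (((hΔ.differentiable (by simp)) p.2).const_smul ν)
  -- components of `curl G = 0` and the coordinate form of `DG`
  have hc : ∀ a b : Fin 3, fderiv ℝ G p.2 (EuclideanSpace.single a 1) b = fderiv ℝ (fun y => G y b) p.2 (EuclideanSpace.single a 1) :=
    fun a b => (fderiv_apply_coord hGd _ b).symm
  have h01 : fderiv ℝ G p.2 (EuclideanSpace.single 0 1) 1 - fderiv ℝ G p.2 (EuclideanSpace.single 1 1) 0 = 0 := by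
    have := congrArg (fun w : EuclideanSpace ℝ (Fin 3) => w 2) hcurl; simpa [curl] using this
  have h12 : fderiv ℝ G p.2 (EuclideanSpace.single 1 1) 2 - fderiv ℝ G p.2 (EuclideanSpace.single 2 1) 1 = 0 := by
    have := congrArg (fun w : EuclideanSpace ℝ (Fin 3) => w 0) hcurl; simpa [curl] using this
  have h20 : fderiv ℝ G p.2 (EuclideanSpace.single 2 1) 0 - fderiv ℝ G p.2 (EuclideanSpace.single 0 1) 2 = 0 := by
    have := congrArg (fun w : EuclideanSpace ℝ (Fin 3) => w 1) hcurl; simpa [curl] using this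
  have hsym : ∀ a b : Fin 3,
      fderiv ℝ G p.2 (EuclideanSpace.single a 1) b = fderiv ℝ G p.2 (EuclideanSpace.single b 1) a := by
    intro a b
    fin_cases a <;> fin_cases b <;>
      (try simp only [Fin.zero_eta, Fin.mk_one, Fin.isValue, Fin.reduceFinMk]) <;>
      first | rfl | linarith [h01, h12, h20]
  -- rewrite the goal through `G`
  rw [← (hcoord k).fderiv_eq, ← (hcoord j).fderiv_eq, ← hc j k, ← hc k j]
  exact hsym j k

/-- On an open region the entries `y ↦ D(u t)(y)[a]·eᵢ` of the velocity gradient are differentiable at every point of the space section. -/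
theorem differentiableAt_fderiv_slice_apply {f : ℝ → EuclideanSpace ℝ (Fin 3) → EuclideanSpace ℝ (Fin 3)} (hU : IsOpen U)
    (h : IsClassicalNSSolutionOnRegion U ν f u q) {p : ℝ × EuclideanSpace ℝ (Fin 3)} (hp : p ∈ U)
    (a : EuclideanSpace ℝ (Fin 3)) (i : Fin 3) :
    DifferentiableAt ℝ (fun y => fderiv ℝ (u p.1) y a i) p.2 := by
  obtain ⟨v, r, V, hv, -, hV, hpV, -, hvu, -⟩ := exists_contDiff_localisation hU h hp
  have hvs : IsSmoothSpaceTimeOn univ v := by rw [IsSmoothSpaceTimeOn, univ_prod_univ]; exact hv.contDiffOn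
  have hvt : ContDiff ℝ ∞ (v p.1) := hvs.contDiff_slice (mem_univ p.1)
  have hgerm : ∀ z ∈ V, uncurry v =ᶠ[𝓝 z] uncurry u := fun z hz => by
    filter_upwards [hV.mem_nhds hz] with w hw using hvu w hw
  have hVt : {y : EuclideanSpace ℝ (Fin 3) | (p.1, y) ∈ V} ∈ 𝓝 p.2 :=
    (hV.preimage (Continuous.prodMk_right p.1)).mem_nhds hpV
  have heq : (fun y => fderiv ℝ (v p.1) y a i) =ᶠ[𝓝 p.2] fun y => fderiv ℝ (u p.1) y a i := by
    filter_upwards [hVt] with y hy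
    rw [fderiv_slice_congr_of_eventuallyEq (hgerm (p.1, y) hy)]
  have hsmooth : ContDiff ℝ ∞ fun y => fderiv ℝ (v p.1) y a i := by
    have h1 : ContDiff ℝ ∞ fun y => fderiv ℝ (v p.1) y a :=
      (hvt.fderiv_right (m := ∞) (by norm_cast)).clm_apply contDiff_const
    exact (EuclideanSpace.proj i : EuclideanSpace ℝ (Fin 3) →L[ℝ] ℝ).contDiff.comp h1
  exact heq.differentiableAt_iff.1 ((hsmooth.differentiable (by simp)) p.2)

/-- The slope `Λ(t,·) = (∂₂u₀∂₀u₂ + ∂₂u₁∂₁u₂)/(∂₀u₂² + ∂₁u₂²)` is differentiable at every point of the space section where `∇ₕu₂ ≠ 0`. -/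
theorem differentiableAt_slope {f : ℝ → EuclideanSpace ℝ (Fin 3) → EuclideanSpace ℝ (Fin 3)} (hU : IsOpen U)
    (h : IsClassicalNSSolutionOnRegion U ν f u q) {p : ℝ × EuclideanSpace ℝ (Fin 3)} (hp : p ∈ U)
    (hnd : fderiv ℝ (u p.1) p.2 (EuclideanSpace.single 0 1) 2 ≠ 0 ∨ fderiv ℝ (u p.1) p.2 (EuclideanSpace.single 1 1) 2 ≠ 0) :
    DifferentiableAt ℝ (fun y =>
      (fderiv ℝ (u p.1) y (EuclideanSpace.single 2 1) 0 * fderiv ℝ (u p.1) y (EuclideanSpace.single 0 1) 2 +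
          fderiv ℝ (u p.1) y (EuclideanSpace.single 2 1) 1 * fderiv ℝ (u p.1) y (EuclideanSpace.single 1 1) 2) /
        (fderiv ℝ (u p.1) y (EuclideanSpace.single 0 1) 2 ^ 2 + fderiv ℝ (u p.1) y (EuclideanSpace.single 1 1) 2 ^ 2)) p.2 := by
  have d20 := differentiableAt_fderiv_slice_apply hU h hp (EuclideanSpace.single 2 1) 0
  have d21 := differentiableAt_fderiv_slice_apply hU h hp (EuclideanSpace.single 2 1) 1
  have d02 := differentiableAt_fderiv_slice_apply hU h hp (EuclideanSpace.single 0 1) 2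
  have d12 := differentiableAt_fderiv_slice_apply hU h hp (EuclideanSpace.single 1 1) 2
  have hnum : DifferentiableAt ℝ (fun y =>
      fderiv ℝ (u p.1) y (EuclideanSpace.single 2 1) 0 * fderiv ℝ (u p.1) y (EuclideanSpace.single 0 1) 2 +
        fderiv ℝ (u p.1) y (EuclideanSpace.single 2 1) 1 * fderiv ℝ (u p.1) y (EuclideanSpace.single 1 1) 2) p.2 :=
    (d20.mul d02).add (d21.mul d12)
  have hden : DifferentiableAt ℝ (fun y =>
      fderiv ℝ (u p.1) y (EuclideanSpace.single 0 1) 2 ^ 2 + fderiv ℝ (u p.1) y (EuclideanSpace.single 1 1) 2 ^ 2) p.2 :=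
    (d02.pow 2).add (d12.pow 2)
  have hne : fderiv ℝ (u p.1) p.2 (EuclideanSpace.single 0 1) 2 ^ 2 + fderiv ℝ (u p.1) p.2 (EuclideanSpace.single 1 1) 2 ^ 2 ≠ 0 := by
    rcases hnd with h0 | h1
    · have : 0 < fderiv ℝ (u p.1) p.2 (EuclideanSpace.single 0 1) 2 ^ 2 := by positivity
      positivity
    · have : 0 < fderiv ℝ (u p.1) p.2 (EuclideanSpace.single 1 1) 2 ^ 2 := by positivity
      positivity
  simp_rw [div_eq_mul_inv]
  exact hnum.mul (hden.inv hne)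

/-- **A slice function with vanishing horizontal derivatives on a ball is a function of the height there**: if `g : ℝ³ → ℝ` is
differentiable with `∂₀g = ∂₁g = 0` at every point of `ball c ρ`, then `g y = g (c + (y₂ − c₂) e₃)` for `y ∈ ball c ρ` (mean value theorem
along the horizontal segment from the vertical axis through `c` to `y`, which stays in the ball by convexity). -/
theorem eq_vertical_of_horizFDeriv_eq_zero {g : EuclideanSpace ℝ (Fin 3) → ℝ} {c : EuclideanSpace ℝ (Fin 3)} {ρ : ℝ}
    (hg : ∀ y ∈ ball c ρ, DifferentiableAt ℝ g y)
    (h0 : ∀ y ∈ ball c ρ, fderiv ℝ g y (EuclideanSpace.single 0 1) = 0)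
    (h1 : ∀ y ∈ ball c ρ, fderiv ℝ g y (EuclideanSpace.single 1 1) = 0)
    {y : EuclideanSpace ℝ (Fin 3)} (hy : y ∈ ball c ρ) :
    g y = g (c + (y 2 - c 2) • EuclideanSpace.single 2 1) := by
  set y' : EuclideanSpace ℝ (Fin 3) := c + (y 2 - c 2) • EuclideanSpace.single 2 1 with hy'
  -- the foot point is in the ball
  have hy'ball : y' ∈ ball c ρ := by
    rw [mem_ball, dist_eq_norm] at hy ⊢
    have e : y' - c = (y 2 - c 2) • (EuclideanSpace.single 2 1 : EuclideanSpace ℝ (Fin 3)) := by rw [hy']; abel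
    have en : ‖y' - c‖ = |y 2 - c 2| := by
      rw [e, norm_smul]; simp
    rw [en]
    refine lt_of_le_of_lt ?_ hy
    have hle : |(y - c) 2| ≤ ‖y - c‖ := by
      rw [← Real.sqrt_sq_eq_abs, EuclideanSpace.norm_eq]
      refine Real.sqrt_le_sqrt ?_
      have hs := Finset.single_le_sum (f := fun j : Fin 3 => ‖(y - c) j‖ ^ 2) (fun j _ => by positivity)
        (Finset.mem_univ (2 : Fin 3))
      simpa [Real.norm_eq_abs, sq_abs] using hs
    simpa using hle
  -- the segment stays in the ball
  have hseg : ∀ s ∈ Icc (0 : ℝ) 1, y' + s • (y - y') ∈ ball c ρ := by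
    intro s hs
    have := (convex_ball c ρ).add_smul_sub_mem hy'ball hy hs
    simpa using this
  -- the difference vector is horizontal
  have hdiff2 : (y - y') 2 = 0 := by simp [hy']
  -- the line function and its (zero) derivative
  set γ : ℝ → EuclideanSpace ℝ (Fin 3) := fun s => y' + s • (y - y') with hγ
  have hγd : ∀ s, HasDerivAt γ (y - y') s := fun s => by
    have := ((hasDerivAt_id s).smul_const (y - y')).const_add y'
    simpa [hγ] using this
  have hderiv : ∀ s ∈ Icc (0 : ℝ) 1, HasDerivAt (fun s => g (γ s)) 0 s := by
    intro s hs
    have hgs : DifferentiableAt ℝ g (γ s) := hg _ (hseg s hs)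
    have hc : HasDerivAt (fun s => g (γ s)) (fderiv ℝ g (γ s) (y - y')) s := hgs.hasFDerivAt.comp_hasDerivAt s (hγd s)
    have hzero : fderiv ℝ g (γ s) (y - y') = 0 := by
      rw [clm_real_apply_coord, Fin.sum_univ_three, h0 _ (hseg s hs), h1 _ (hseg s hs), hdiff2]
      ring
    rw [hzero] at hc
    exact hc
  have hconst := constant_of_has_deriv_right_zero (f := fun s => g (γ s)) (a := 0) (b := 1)
    (fun s hs => (hderiv s hs).continuousAt.continuousWithinAt)
    (fun s hs => ((hderiv s ⟨hs.1, hs.2.le⟩).hasDerivWithinAt))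
  have e1 : g (γ 1) = g (γ 0) := hconst 1 ⟨zero_le_one, le_rfl⟩
  have hγ1 : γ 1 = y := by simp [hγ]
  have hγ0 : γ 0 = y' := by simp [hγ]
  rw [hγ1, hγ0] at e1
  exact e1


/-- **REDUCTION: `stub_localThickTH` (line `local_rigidity` v1, crux 19708) follows from ONE velocity-only local statement `hempty_thick`.**

`hempty_thick`: there is NO real-analytic velocity field `u` on an open space–time set `U ∋ p₀` such that on `U`
 (i) `∂₀u₀ + ∂₁u₁ + ∂₂u₂ = 0`; (ii) `∂₀u₁ = ∂₁u₀` (poloidal); (iii) `∂₂u₀·∂₁u₂ − ∂₂u₁·∂₀u₂ = 0` (frozen law / common slope);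
 (iv) for all `j k`, `∂_j(𝓛u_k) = ∂_k(𝓛u_j)` where `𝓛u_k(t,y) = ∂ₜu_k + Du_k(y)[u] − Δu_k` (the vorticity equation, pressure-free, nsreg-p7 shapes);
and AT `p₀`: twist `∂₀(∂₂u₂)∂₁u₂ − ∂₁(∂₂u₂)∂₀u₂ ≠ 0`, `∇ₕu₂ ≠ 0`, `∂₂u_h ≠ 0`, `curl u ≠ 0`, and THICKNESS: the slope
`Λ(t,y) = (∂₂u₀∂₀u₂ + ∂₂u₁∂₁u₂)/(∂₀u₂² + ∂₁u₂²)` has `∂₀Λ(p₀) ≠ 0 ∨ ∂₁Λ(p₀) ≠ 0`.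

Proof: laws (i)–(iv) hold on `U`; either some point is thick (then `hempty_thick` bites) or `∂₀Λ = ∂₁Λ = 0` on `U` and on a ball the slope is
`m(t,y₂) := Λ(t, c + (y₂−c₂)e₃)`.  Navier–Stokes regularity is NOT touched; no class input, no analyticity is used. -/
theorem stub_localThickTH_of_localEmptyThick
    (hempty_thick : ∀ (u : ℝ → EuclideanSpace ℝ (Fin 3) → EuclideanSpace ℝ (Fin 3))
      (U : Set (ℝ × EuclideanSpace ℝ (Fin 3))) (p₀ : ℝ × EuclideanSpace ℝ (Fin 3)),
      IsOpen U → p₀ ∈ U →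
      AnalyticOnNhd ℝ (Function.uncurry u) U →
      (∀ p ∈ U, fderiv ℝ (u p.1) p.2 (EuclideanSpace.single 0 1) 0 + fderiv ℝ (u p.1) p.2 (EuclideanSpace.single 1 1) 1 +
        fderiv ℝ (u p.1) p.2 (EuclideanSpace.single 2 1) 2 = 0) →
      (∀ p ∈ U, fderiv ℝ (u p.1) p.2 (EuclideanSpace.single 0 1) 1 = fderiv ℝ (u p.1) p.2 (EuclideanSpace.single 1 1) 0) →
      (∀ p ∈ U, fderiv ℝ (u p.1) p.2 (EuclideanSpace.single 2 1) 0 * fderiv ℝ (u p.1) p.2 (EuclideanSpace.single 1 1) 2 -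
        fderiv ℝ (u p.1) p.2 (EuclideanSpace.single 2 1) 1 * fderiv ℝ (u p.1) p.2 (EuclideanSpace.single 0 1) 2 = 0) →
      (∀ p ∈ U, ∀ j k : Fin 3,
        fderiv ℝ (fun y => deriv (fun s => u s y k) p.1 + fderiv ℝ (fun y' => u p.1 y' k) y (u p.1 y) -
            (Δ (fun y' => u p.1 y' k)) y) p.2 (EuclideanSpace.single j 1) =
          fderiv ℝ (fun y => deriv (fun s => u s y j) p.1 + fderiv ℝ (fun y' => u p.1 y' j) y (u p.1 y) -
            (Δ (fun y' => u p.1 y' j)) y) p.2 (EuclideanSpace.single k 1)) →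
      fderiv ℝ (fun y => fderiv ℝ (u p₀.1) y (EuclideanSpace.single 2 1) 2) p₀.2 (EuclideanSpace.single 0 1) *
            fderiv ℝ (u p₀.1) p₀.2 (EuclideanSpace.single 1 1) 2 -
          fderiv ℝ (fun y => fderiv ℝ (u p₀.1) y (EuclideanSpace.single 2 1) 2) p₀.2 (EuclideanSpace.single 1 1) *
            fderiv ℝ (u p₀.1) p₀.2 (EuclideanSpace.single 0 1) 2 ≠ 0 →
      (fderiv ℝ (u p₀.1) p₀.2 (EuclideanSpace.single 0 1) 2 ≠ 0 ∨ fderiv ℝ (u p₀.1) p₀.2 (EuclideanSpace.single 1 1) 2 ≠ 0) →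
      (fderiv ℝ (u p₀.1) p₀.2 (EuclideanSpace.single 2 1) 0 ≠ 0 ∨ fderiv ℝ (u p₀.1) p₀.2 (EuclideanSpace.single 2 1) 1 ≠ 0) →
      Literature.Analysis.FluidPDE.curl (u p₀.1) p₀.2 ≠ 0 →
      (fderiv ℝ (fun y =>
            (fderiv ℝ (u p₀.1) y (EuclideanSpace.single 2 1) 0 * fderiv ℝ (u p₀.1) y (EuclideanSpace.single 0 1) 2 +
                fderiv ℝ (u p₀.1) y (EuclideanSpace.single 2 1) 1 * fderiv ℝ (u p₀.1) y (EuclideanSpace.single 1 1) 2) /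
              (fderiv ℝ (u p₀.1) y (EuclideanSpace.single 0 1) 2 ^ 2 + fderiv ℝ (u p₀.1) y (EuclideanSpace.single 1 1) 2 ^ 2))
            p₀.2 (EuclideanSpace.single 0 1) ≠ 0 ∨
        fderiv ℝ (fun y =>
            (fderiv ℝ (u p₀.1) y (EuclideanSpace.single 2 1) 0 * fderiv ℝ (u p₀.1) y (EuclideanSpace.single 0 1) 2 +
                fderiv ℝ (u p₀.1) y (EuclideanSpace.single 2 1) 1 * fderiv ℝ (u p₀.1) y (EuclideanSpace.single 1 1) 2) /
              (fderiv ℝ (u p₀.1) y (EuclideanSpace.single 0 1) 2 ^ 2 + fderiv ℝ (u p₀.1) y (EuclideanSpace.single 1 1) 2 ^ 2))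
            p₀.2 (EuclideanSpace.single 1 1) ≠ 0) →
      False) :
    ∀ (u : ℝ → EuclideanSpace ℝ (Fin 3) → EuclideanSpace ℝ (Fin 3)) (q : ℝ → EuclideanSpace ℝ (Fin 3) → ℝ)
      (U : Set (ℝ × EuclideanSpace ℝ (Fin 3))),
      IsOpen U → U.Nonempty →
      Literature.Analysis.FluidPDE.IsClassicalNSSolutionOnRegion U 1 0 u q →
      AnalyticOnNhd ℝ (Function.uncurry u) U →
      (∀ p ∈ U, ⟪Literature.Analysis.FluidPDE.curl (u p.1) p.2, EuclideanSpace.single 2 1⟫_ℝ = 0) →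
      (∀ p ∈ U, Literature.Analysis.FluidPDE.curl (u p.1) p.2 ≠ 0 ∧
        (fderiv ℝ (u p.1) p.2 (EuclideanSpace.single 0 1) 2 ≠ 0 ∨ fderiv ℝ (u p.1) p.2 (EuclideanSpace.single 1 1) 2 ≠ 0) ∧
        (fderiv ℝ (u p.1) p.2 (EuclideanSpace.single 2 1) 0 ≠ 0 ∨ fderiv ℝ (u p.1) p.2 (EuclideanSpace.single 2 1) 1 ≠ 0)) →
      (∀ p ∈ U,
        fderiv ℝ (fun y => fderiv ℝ (u p.1) y (EuclideanSpace.single 2 1) 2) p.2 (EuclideanSpace.single 0 1) *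
            fderiv ℝ (u p.1) p.2 (EuclideanSpace.single 1 1) 2 -
          fderiv ℝ (fun y => fderiv ℝ (u p.1) y (EuclideanSpace.single 2 1) 2) p.2 (EuclideanSpace.single 1 1) *
            fderiv ℝ (u p.1) p.2 (EuclideanSpace.single 0 1) 2 ≠ 0) →
      ∃ U₁ : Set (ℝ × EuclideanSpace ℝ (Fin 3)), U₁ ⊆ U ∧ IsOpen U₁ ∧ U₁.Nonempty ∧
        ∃ m : ℝ → ℝ → ℝ, ∀ p ∈ U₁, ∀ b : Fin 3, b ≠ 2 →
          fderiv ℝ (u p.1) p.2 (EuclideanSpace.single 2 1) b =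
            m p.1 (p.2 2) * fderiv ℝ (u p.1) p.2 (EuclideanSpace.single b 1) 2 := by
  intro u q U hU hne hNS han hpol hnd htw
  -- the slope, as a slice function
  set Λ : ℝ → EuclideanSpace ℝ (Fin 3) → ℝ := fun t y =>
    (fderiv ℝ (u t) y (EuclideanSpace.single 2 1) 0 * fderiv ℝ (u t) y (EuclideanSpace.single 0 1) 2 +
        fderiv ℝ (u t) y (EuclideanSpace.single 2 1) 1 * fderiv ℝ (u t) y (EuclideanSpace.single 1 1) 2) /
      (fderiv ℝ (u t) y (EuclideanSpace.single 0 1) 2 ^ 2 + fderiv ℝ (u t) y (EuclideanSpace.single 1 1) 2 ^ 2) with hΛ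
  by_cases hth : ∃ p ∈ U, fderiv ℝ (Λ p.1) p.2 (EuclideanSpace.single 0 1) ≠ 0 ∨ fderiv ℝ (Λ p.1) p.2 (EuclideanSpace.single 1 1) ≠ 0
  · -- a THICK point: `hempty_thick` bites
    exfalso
    obtain ⟨p₀, hp₀, hth⟩ := hth
    refine hempty_thick u U p₀ hU hp₀ han ?_ ?_ ?_ ?_ (htw p₀ hp₀) (hnd p₀ hp₀).2.1 (hnd p₀ hp₀).2.2 (hnd p₀ hp₀).1 ?_
    · intro p hp
      rw [← divergence_eq_sum_three]; exact hNS.divFree p.1 p.2 hp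
    · intro p hp
      have h2 : curl (u p.1) p.2 2 = 0 := by simpa [EuclideanSpace.inner_single_right] using hpol p hp
      have := curl_apply_two' (u p.1) p.2
      rw [h2] at this
      linarith
    · intro p hp
      exact vertShear_wedge_horizGrad_eq_zero hU hNS hpol hp
    · intro p hp j k
      have := vorticity_law hU hNS hp j k
      simpa using this
    · simpa [hΛ] using hth
  · -- no thick point: the slope has vanishing horizontal derivatives on all of `U`
    push Not at hth
    obtain ⟨p₁, hp₁⟩ := hne
    obtain ⟨ρ, hρ, hball⟩ := Metric.isOpen_iff.1 hU p₁ hp₁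
    refine ⟨ball p₁ ρ, hball, isOpen_ball, ⟨p₁, mem_ball_self hρ⟩,
      fun t ζ => Λ t (p₁.2 + (ζ - p₁.2 2) • EuclideanSpace.single 2 1), ?_⟩
    intro p hp b hb
    have hpU : p ∈ U := hball hp
    -- the slope law at `p`
    rw [vertShear_eq_slope_mul hU hNS hpol hpU (hnd p hpU).2.1 b hb]
    congr 1
    -- the space section of the product ball at time `p.1` is the ball `ball p₁.2 ρ`
    have ht : dist p.1 p₁.1 < ρ := lt_of_le_of_lt (le_max_left _ _) (by simpa [Prod.dist_eq] using mem_ball.1 hp)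
    have hsec : ∀ y ∈ ball p₁.2 ρ, (p.1, y) ∈ U := fun y hy => by
      refine hball (mem_ball.2 ?_)
      rw [Prod.dist_eq]
      exact max_lt ht (mem_ball.1 hy)
    have hy : p.2 ∈ ball p₁.2 ρ := by
      have := mem_ball.1 hp
      rw [Prod.dist_eq] at this
      exact mem_ball.2 (lt_of_le_of_lt (le_max_right _ _) this)
    show Λ p.1 p.2 = Λ p.1 (p₁.2 + (p.2 2 - p₁.2 2) • EuclideanSpace.single 2 1)
    refine eq_vertical_of_horizFDeriv_eq_zero (g := Λ p.1) (c := p₁.2) (ρ := ρ) ?_ ?_ ?_ hy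
    · intro y hy'
      have := differentiableAt_slope hU hNS (hsec y hy') (hnd (p.1, y) (hsec y hy')).2.1
      simpa [hΛ] using this
    · intro y hy'; exact (hth (p.1, y) (hsec y hy')).1
    · intro y hy'; exact (hth (p.1, y) (hsec y hy')).2

end Summit.NavierStokesRegularity.NavierStokesRegularity.Theorems.PoloidalWindowDoorPoloidalWindowRigidityLocalThickOfLocalEmpty

end
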